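import Literature.NumberTheory.Irrationality.LaiSprangZudilin2026.PadicPoleSeries
import Literature.NumberTheory.Irrationality.LaiSprangZudilin2026.ArithmeticProofs
import HarnessLib

/-!
# Lai–Sprang–Zudilin 2026, Lemma 5.3 (II): the window theorem and `lemma53_holds`

Topic `Literature/NumberTheory/Irrationality/LaiSprangZudilin2026`.  Source: L. Lai, J. Sprang, W. Zudilin,
*A note on the irrationality of `ζ₂(5)`*, IMRN **2026**:16, rnag180 = arXiv:2505.05005 [LaiSprangZudilin2026],
§5: «Lemma 5.3. For any prime `p > max{√(2n), 3}`, we have `v_p(ρ_{n,0}) ≥ −5`.» with (def_rho_0-new)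
«`ρ_{n,0} = −Σ_{ℓ=1}^{n} ( Σ_{k=ℓ}^{n} Σ_{i=1}^{4} i(i+1) r_{n,i,k}/(ℓ−½)^{i+2} )`» (text p0008–p0009, read on the
page).  Continuation of `PadicPoleSeries.lean`; DISCHARGES the named fact `lemma53` of `SecondSolution.lean`
(`lemma53_holds`), which makes `lemma54_of_lemma53` (`ArithmeticProofs.lean`) unconditional (`lemma54`: LSZ Lemma 5.4
as a theorem).

## Proof (elementary; replaces the printed Andrews/`₁₃V₁₂` transformation — see the module doc of `PadicPoleSeries.lean`)

For a shift `ℓ` with `p ∤ 2ℓ−1` every term of (def_rho_0-new) has `ord_p ≥ −(4−i) ≥ −3` (`𝒯_k` is `p`-integral).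
For `p ∣ 2ℓ − 1 = pc` (`c` odd, `c < p`, `ℓ = c₁p + h + 1`, `p = 2h+1`, `c = 2c₁+1`) the inner sum equals
`p^{−6}·Σ_{k=ℓ}^{n} Σ_i ω_i [X^{4−i}]𝒯_k` with `p`-integral weights `ω_i = i(i+1)2^{i+2}c^{−i−2}`, and
**`window_sum`**: `Σ_{k=ℓ}^{n} Σ_i ω_i [X^{4−i}]𝒯_k ≡ 0 (mod p)`.  Indeed by `pTaylor_Rreg_congr` the `k`-th term is
`≡ (n−2k)A_k^4·Φ(⌊k/p⌋)`; writing `k = qp + r`, `n = n'p + m₀`: for `r > m₀` (a borrow) `p ∣ A_k`; for `r ≤ m₀`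
Lucas gives `A_k ≡ binom(2q,q)binom(2(n'−q),n'−q)·binom(2r,r)binom(2(m₀−r),m₀−r)` and `n−2k ≡ m₀−2r`
(`Y_congr_Z`), so the block `q` of the sum is `β(q)Φ(q)·Σ_{r=0}^{m₀}(m₀−2r)·(binom(2r,r)binom(2(m₀−r),m₀−r))^4`,
which VANISHES under the reflection `r ↦ m₀ − r` (`window_antisymm`); the block `q = c₁` only contains `r ≥ h+1`,
where `p ∣ binom(2r,r)`; lower blocks are empty (`sum_termZ`).  Hence `ord_p ρ_{n,0} ≥ −6 + 1 = −5`
(`padicOrdGe_pfRho0`, for EVERY odd prime with `2n < p²` — the case `p > n`, where the dangerous shift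
`ℓ = (p+1)/2` may still occur, is covered by the same argument since then every `k ≥ ℓ` has `p ∣ binom(2k,k)`).
Everything here is PROVED; net effect: the named fact `lemma53` is discharged.

HONEST FRAMING (cell zeta5-irr, rung F-Z1): a published 2026 lemma about the 2-adic `ζ₂(5)` linear forms,
re-proved in the kernel by an elementary route; nothing here concerns `ζ(5)`; (5.2) «den-con» NOT proved;
rung F-Z1 not moved.
-/

noncomputable section

namespace Literature.NumberTheory.Irrationality.LaiSprangZudilin2026

open Finset Filter PowerSeries Literature.Analysis.Calculus Literature.NumberTheory.Transcendental
open Literature.NumberTheory.Irrationality.RivoalZudilin2020 (halfBrick Greg Greg_eq)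
open scoped Nat

namespace Lemma53

variable {p : ℕ}

/-! ### Scalar congruences modulo `p` -/

/-- [cite: LaiSprangZudilin2026, §5 (proof of Lemma 5.3)] -/
theorem padicOrdGe_neg {v : ℤ} {x : ℚ} (h : PadicOrdGe p v x) : PadicOrdGe p v (-x) := by
  rcases h with h | h
  · exact Or.inl (by rw [h, neg_zero])
  · exact Or.inr (by rwa [padicValRat.neg])

/-- [cite: LaiSprangZudilin2026, §5 (proof of Lemma 5.3)] -/
theorem padicOrdGe_sub [Fact p.Prime] {v : ℤ} {x y : ℚ} (hx : PadicOrdGe p v x) (hy : PadicOrdGe p v y) :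
    PadicOrdGe p v (x - y) := by
  rw [sub_eq_add_neg]; exact hx.add (padicOrdGe_neg hy)

/-- `a ≡ b (mod p)` for naturals gives `ord_p (a − b) ≥ 1` in `ℚ`. [cite: LaiSprangZudilin2026, §5 (proof of Lemma 5.3)] -/
theorem padicOrdGe_one_of_modEq [hp : Fact p.Prime] {a b : ℕ} (h : a ≡ b [MOD p]) :
    PadicOrdGe p 1 ((a : ℚ) - b) := by
  obtain ⟨w, hw⟩ := (Nat.modEq_iff_dvd.1 h)
  have e : (a : ℚ) - b = (p : ℚ) * (-w : ℤ) := by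
    have : ((b : ℤ) - a : ℤ) = p * w := hw
    have h2 : ((a : ℚ) - b) = (((a : ℤ) - b : ℤ) : ℚ) := by push_cast; ring
    rw [h2, show (a : ℤ) - b = p * (-w) by linarith]
    push_cast; ring
  rw [e]
  simpa using (padicOrdGe_one_natCast p).mul (PadicOrdGe.of_int (p := p) (-w))

/-- Products of congruent `p`-integral numbers are congruent. [cite: LaiSprangZudilin2026, §5 (proof of Lemma 5.3)] -/
theorem padicOrdGe_mul_congr [Fact p.Prime] {a a' b b' : ℚ} (ha : PadicOrdGe p 0 a) (hb' : PadicOrdGe p 0 b')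
    (h1 : PadicOrdGe p 1 (a - a')) (h2 : PadicOrdGe p 1 (b - b')) : PadicOrdGe p 1 (a * b - a' * b') := by
  have e : a * b - a' * b' = a * (b - b') + (a - a') * b' := by ring
  rw [e]
  simpa using (ha.mul h2).add (h1.mul hb')

/-- Powers of congruent `p`-integral numbers are congruent. [cite: LaiSprangZudilin2026, §5 (proof of Lemma 5.3)] -/
theorem padicOrdGe_pow_congr [Fact p.Prime] {a a' : ℚ} (ha : PadicOrdGe p 0 a) (ha' : PadicOrdGe p 0 a')
    (h1 : PadicOrdGe p 1 (a - a')) (m : ℕ) : PadicOrdGe p 1 (a ^ m - a' ^ m) := by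
  induction m with
  | zero => simpa using PadicOrdGe.zero (p := p) 1
  | succ m ih =>
    rw [pow_succ, pow_succ]
    exact padicOrdGe_mul_congr (by simpa using ha.pow m) ha' ih h1

/-- A `p`-integral linear combination of the coefficients of a `PSOrdGe p v` series has order `≥ v`. [cite: LaiSprangZudilin2026, §5 (proof of Lemma 5.3)] -/
theorem padicOrdGe_wsum [Fact p.Prime] {v : ℤ} {F : ℚ⟦X⟧} (hF : PSOrdGe p v F) {ω : ℕ → ℚ} {s : Finset ℕ}
    (hω : ∀ i ∈ s, PadicOrdGe p 0 (ω i)) (c : ℕ → ℕ) :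
    PadicOrdGe p v (∑ i ∈ s, ω i * coeff (c i) F) :=
  PadicOrdGe.sum fun i hi => by simpa using (hω i hi).mul (hF (c i))

/-- `ord_p (a − 2b) ≥ 0` for naturals `a, b`. [cite: LaiSprangZudilin2026, §5 (proof of Lemma 5.3)] -/
theorem padicOrdGe_sub_two_mul [Fact p.Prime] (a b : ℕ) : PadicOrdGe p 0 ((a : ℚ) - 2 * (b : ℚ)) :=
  padicOrdGe_sub (PadicOrdGe.of_nat a) (by simpa using (PadicOrdGe.of_nat (p := p) 2).mul (PadicOrdGe.of_nat b))

/-! ### Digits without borrow -/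

/-- If the last digit of `k` is at most that of `n` (`k ≤ n`), then `(n−k)/p = n/p − k/p` and
`(n−k) mod p = n mod p − k mod p`. [cite: LaiSprangZudilin2026, §5 (proof of Lemma 5.3)] -/
theorem digits_of_noborrow [hp : Fact p.Prime] {n k : ℕ} (hk : k ≤ n) (hr : k % p ≤ n % p) :
    (n - k) / p = n / p - k / p ∧ (n - k) % p = n % p - k % p := by
  have hp0 : 0 < p := hp.out.pos
  have ek := Nat.div_add_mod k p
  have en := Nat.div_add_mod n p
  have hrn : n % p < p := Nat.mod_lt _ hp0
  have hq : k / p ≤ n / p := Nat.div_le_div_right hk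
  have hmul := Nat.mul_le_mul_left p hq
  have e : n % p - k % p + p * (n / p - k / p) = n - k := by
    rw [Nat.mul_sub]; omega
  exact (Nat.div_mod_unique hp0).2 ⟨e, by omega⟩

/-! ### The window sum -/

section window

variable [hp : Fact p.Prime]

/-- The weight `Φ(q) = Σ_i ω_i · [X^{4−i}] Λ(q)` of a digit block. [cite: LaiSprangZudilin2026, §5 (proof of Lemma 5.3)] -/
def Phi (p n : ℕ) (ω : ℕ → ℚ) (q : ℕ) : ℚ := ∑ i ∈ Icc 1 4, ω i * coeff (4 - i) (Lam p n q)

omit hp in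
/-- [cite: LaiSprangZudilin2026, §5 (proof of Lemma 5.3)] -/
theorem padicOrdGe_Phi [Fact p.Prime] (hp2 : p ≠ 2) {n : ℕ} (hn : 2 * n < p ^ 2) {ω : ℕ → ℚ}
    (hω : ∀ i ∈ Icc 1 4, PadicOrdGe p 0 (ω i)) {q : ℕ} (hq : q ≤ n / p) : PadicOrdGe p 0 (Phi p n ω q) :=
  padicOrdGe_wsum (psOrdGe_Lam hp2 hn hq) hω _

/-- `β(q)·b(r)`: the Lucas factorisation of `A_k^4` for `k = qp + r` without borrow.
[cite: LaiSprangZudilin2026, §5 (proof of Lemma 5.3)] -/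
def blockA (p n q r : ℕ) : ℚ :=
  ((Nat.centralBinom q * Nat.centralBinom (n / p - q) : ℕ) : ℚ) ^ 4 *
    ((Nat.centralBinom r * Nat.centralBinom (n % p - r) : ℕ) : ℚ) ^ 4

/-- The digit model `Z_k` of `Y_k = (n−2k)A_k^4Φ(k/p)`: `(m₀ − 2r)·β(q)b(r)·Φ(q)` if `r ≤ m₀`, else `0`
(`k = qp + r`, `n = n'p + m₀`). [cite: LaiSprangZudilin2026, §5 (proof of Lemma 5.3)] -/
def termZ (p n : ℕ) (ω : ℕ → ℚ) (k : ℕ) : ℚ :=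
  if k % p ≤ n % p then (((n % p : ℕ) : ℚ) - 2 * ((k % p : ℕ) : ℚ)) * blockA p n (k / p) (k % p) * Phi p n ω (k / p)
  else 0

/-- **`Y_k ≡ Z_k (mod p)`** for every `k ≤ n`: Lucas' theorem digit by digit at good poles, `p ∣ A_k` and
`p ∣ binom(2r,r)binom(2(m₀−r),m₀−r)` at bad ones. [cite: LaiSprangZudilin2026, §5 (proof of Lemma 5.3)] -/
theorem Y_congr_Z (hp2 : p ≠ 2) {n k : ℕ} (hk : k ≤ n) (hn : 2 * n < p ^ 2) {ω : ℕ → ℚ}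
    (hω : ∀ i ∈ Icc 1 4, PadicOrdGe p 0 (ω i)) :
    PadicOrdGe p 1 (((n : ℚ) - 2 * k) * Aval n k ^ 4 * Phi p n ω (k / p) - termZ p n ω k) := by
  have hp0 : 0 < p := hp.out.pos
  have hodd := two_mul_half_add_one hp2
  have hΦ : PadicOrdGe p 0 (Phi p n ω (k / p)) := padicOrdGe_Phi hp2 hn hω (Nat.div_le_div_right hk)
  have hnk : PadicOrdGe p 0 ((n : ℚ) - 2 * k) := by simpa using PadicOrdGe.of_int (p := p) ((n : ℤ) - 2 * k)
  have hA0 : PadicOrdGe p 0 (Aval n k) := by rw [Aval]; exact PadicOrdGe.of_nat _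
  -- `Y_k ≡ 0` at a bad pole
  have hYbad : ¬ Good p n k → PadicOrdGe p 1 (((n : ℚ) - 2 * k) * Aval n k ^ 4 * Phi p n ω (k / p)) := by
    intro hb
    have := (hnk.mul ((padicOrdGe_Aval_bad hp2 hb).pow 4)).mul hΦ
    exact this.mono (by norm_num)
  unfold termZ
  split_ifs with hr
  · obtain ⟨hdq, hdr⟩ := digits_of_noborrow hk hr
    have ek := Nat.div_add_mod k p
    have en := Nat.div_add_mod n p
    -- the scalar `(n − 2k) ≡ (m₀ − 2r)`
    have hs : PadicOrdGe p 1 (((n : ℚ) - 2 * k) - (((n % p : ℕ) : ℚ) - 2 * ((k % p : ℕ) : ℚ))) := by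
      have e : ((n : ℚ) - 2 * k) - (((n % p : ℕ) : ℚ) - 2 * ((k % p : ℕ) : ℚ)) =
          (p : ℚ) * (((n / p : ℕ) : ℚ) - 2 * ((k / p : ℕ) : ℚ)) := by
        have h1 : (n : ℚ) = (p : ℚ) * ((n / p : ℕ) : ℚ) + ((n % p : ℕ) : ℚ) := by exact_mod_cast en.symm
        have h2 : (k : ℚ) = (p : ℚ) * ((k / p : ℕ) : ℚ) + ((k % p : ℕ) : ℚ) := by exact_mod_cast ek.symm
        rw [h1, h2]; ring
      rw [e]
      simpa using (padicOrdGe_one_natCast p).mul (padicOrdGe_sub_two_mul (p := p) (n / p) (k / p))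
    have hs0 : PadicOrdGe p 0 (((n % p : ℕ) : ℚ) - 2 * ((k % p : ℕ) : ℚ)) := padicOrdGe_sub_two_mul _ _
    have hB0 : PadicOrdGe p 0 (blockA p n (k / p) (k % p)) := by
      unfold blockA
      exact (((PadicOrdGe.of_nat _).pow 4).mul ((PadicOrdGe.of_nat _).pow 4)).mono (by norm_num)
    by_cases hg : Good p n k
    · -- Lucas at both factors
      have h1 := centralBinom_modEq_of_digit hp2 hg.1 (p := p)
      have h2 := centralBinom_modEq_of_digit hp2 hg.2 (p := p)
      rw [hdq, hdr] at h2
      have h12 := h1.mul h2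
      have hA1 : PadicOrdGe p 1 (Aval n k -
          (((Nat.centralBinom (k / p) * Nat.centralBinom (n / p - k / p) : ℕ) : ℚ) *
            ((Nat.centralBinom (k % p) * Nat.centralBinom (n % p - k % p) : ℕ) : ℚ))) := by
        have := padicOrdGe_one_of_modEq h12
        rw [Aval]
        convert this using 2
        push_cast; ring
      have hA4 : PadicOrdGe p 1 (Aval n k ^ 4 - blockA p n (k / p) (k % p)) := by
        rw [blockA, ← mul_pow]
        exact padicOrdGe_pow_congr hA0 ((PadicOrdGe.of_nat _).mul (PadicOrdGe.of_nat _) |>.mono (by norm_num)) hA1 4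
      have hprod := padicOrdGe_mul_congr hnk hB0 hs hA4
      have := padicOrdGe_mul_congr (hnk.mul (hA0.pow 4) |>.mono (by norm_num)) hΦ hprod
        (by rw [sub_self]; exact PadicOrdGe.zero 1 : PadicOrdGe p 1 (Phi p n ω (k / p) - Phi p n ω (k / p)))
      simpa [mul_assoc] using this
    · -- bad pole without borrow: a digit of `k` or of `n − k` exceeds `h`
      have hZ : PadicOrdGe p 1 ((((n % p : ℕ) : ℚ) - 2 * ((k % p : ℕ) : ℚ)) * blockA p n (k / p) (k % p) *
          Phi p n ω (k / p)) := by
        have hdvd : p ∣ Nat.centralBinom (k % p) * Nat.centralBinom (n % p - k % p) := by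
          unfold Good at hg
          rcases not_and_or.1 hg with h | h
          · refine (dvd_centralBinom_of_digit hp2 (m := k % p) ?_).mul_right _
            rw [Nat.mod_mod]; exact not_le.1 h
          · refine (dvd_centralBinom_of_digit hp2 (m := n % p - k % p) ?_).mul_left _
            rw [← hdr, Nat.mod_mod]; exact not_le.1 h
        have hne : Nat.centralBinom (k % p) * Nat.centralBinom (n % p - k % p) ≠ 0 :=
          mul_ne_zero (Nat.centralBinom_ne_zero _) (Nat.centralBinom_ne_zero _)
        have hb1 : PadicOrdGe p 1 (((Nat.centralBinom (k % p) * Nat.centralBinom (n % p - k % p) : ℕ) : ℚ)) := by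
          refine PadicOrdGe.of_eq ?_
          rw [padicValRat.of_nat]
          exact_mod_cast one_le_padicValNat_of_dvd hne hdvd
        have hB1 : PadicOrdGe p 1 (blockA p n (k / p) (k % p)) := by
          unfold blockA
          exact ((PadicOrdGe.of_nat (p := p) _).pow 4 |>.mul (hb1.pow 4)).mono (by norm_num)
        exact ((hs0.mul hB1).mul hΦ).mono (by norm_num)
      exact padicOrdGe_sub (hYbad hg) hZ
  · rw [sub_zero]
    refine hYbad fun hg => hr ?_
    exact (digits_of_good hp2 hk hg.1 hg.2).1

/-- The reflection `r ↦ m₀ − r`: `Σ_{r ≤ m₀} (m₀ − 2r)·(binom(2r,r)binom(2(m₀−r),m₀−r))^4·C₀ = 0`.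
[cite: LaiSprangZudilin2026, §5 (proof of Lemma 5.3)] -/
theorem window_antisymm (m₀ : ℕ) (C₀ : ℚ) :
    ∑ r ∈ range (m₀ + 1), ((m₀ : ℚ) - 2 * r) *
      (((Nat.centralBinom r * Nat.centralBinom (m₀ - r) : ℕ) : ℚ) ^ 4 * C₀) = 0 := by
  set S := ∑ r ∈ range (m₀ + 1), ((m₀ : ℚ) - 2 * r) *
      (((Nat.centralBinom r * Nat.centralBinom (m₀ - r) : ℕ) : ℚ) ^ 4 * C₀) with hS
  have h : S = -S := by
    conv_lhs => rw [hS, ← sum_range_reflect]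
    rw [hS, ← sum_neg_distrib]
    refine sum_congr rfl fun r hr => ?_
    have hr' : r ≤ m₀ := Nat.lt_succ_iff.1 (mem_range.1 hr)
    rw [show m₀ + 1 - 1 - r = m₀ - r by omega, Nat.sub_sub_self hr', Nat.cast_sub hr',
      mul_comm (Nat.centralBinom (m₀ - r))]
    ring
  linarith

/-- **The window theorem for the digit model**: for a dangerous shift `ℓ = c'p + h + 1 ≤ n`,
`Σ_{k=ℓ}^{n} Z_k ≡ 0 (mod p)` — the block `k/p = c'` has units digits `> h`, and every higher block is a complete
reflection-symmetric window. [cite: LaiSprangZudilin2026, §5 (proof of Lemma 5.3)] -/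
theorem sum_termZ (hp2 : p ≠ 2) {n c₁ : ℕ} (hn : 2 * n < p ^ 2) {ω : ℕ → ℚ}
    (hω : ∀ i ∈ Icc 1 4, PadicOrdGe p 0 (ω i)) :
    PadicOrdGe p 1 (∑ k ∈ Icc (c₁ * p + p / 2 + 1) n, termZ p n ω k) := by
  have hp0 : 0 < p := hp.out.pos
  have hodd := two_mul_half_add_one hp2
  set ℓ := c₁ * p + p / 2 + 1 with hℓ
  -- group by the leading digit `q = k / p`
  have hmaps : ∀ k ∈ Icc ℓ n, k / p ∈ range (n / p + 1) := fun k hk =>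
    mem_range.2 (Nat.lt_succ_of_le (Nat.div_le_div_right (mem_Icc.1 hk).2))
  rw [← sum_fiberwise_of_maps_to hmaps]
  refine PadicOrdGe.sum fun q hq => ?_
  have hqn : q ≤ n / p := Nat.lt_succ_iff.1 (mem_range.1 hq)
  rcases lt_trichotomy q c₁ with hlt | heq | hgt
  · -- empty block
    have : (Icc ℓ n).filter (fun k => k / p = q) = ∅ := by
      refine filter_false_of_mem fun k hk => ?_
      have hkl : ℓ ≤ k := (mem_Icc.1 hk).1
      intro hkq
      have : c₁ ≤ k / p := (Nat.le_div_iff_mul_le hp0).2 (by omega)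
      omega
    rw [this, sum_empty]; exact PadicOrdGe.zero 1
  · -- the block of `ℓ` itself: units digit `≥ h + 1`
    refine PadicOrdGe.sum fun k hk => ?_
    obtain ⟨hk1, hkq⟩ := mem_filter.1 hk
    have hkl : ℓ ≤ k := (mem_Icc.1 hk1).1
    have hkn : k ≤ n := (mem_Icc.1 hk1).2
    have ek := Nat.div_add_mod k p
    rw [hkq, heq] at ek
    have hr : p / 2 < k % p := by
      have : c₁ * p = p * c₁ := mul_comm _ _
      omega
    unfold termZ
    split_ifs with hrm
    · have hdvd : p ∣ Nat.centralBinom (k % p) * Nat.centralBinom (n % p - k % p) := by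
        refine (dvd_centralBinom_of_digit hp2 (m := k % p) ?_).mul_right _
        rwa [Nat.mod_mod]
      have hne : Nat.centralBinom (k % p) * Nat.centralBinom (n % p - k % p) ≠ 0 :=
        mul_ne_zero (Nat.centralBinom_ne_zero _) (Nat.centralBinom_ne_zero _)
      have hb1 : PadicOrdGe p 1 (((Nat.centralBinom (k % p) * Nat.centralBinom (n % p - k % p) : ℕ) : ℚ)) := by
        refine PadicOrdGe.of_eq ?_
        rw [padicValRat.of_nat]
        exact_mod_cast one_le_padicValNat_of_dvd hne hdvd
      have hB1 : PadicOrdGe p 1 (blockA p n (k / p) (k % p)) := by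
        unfold blockA
        exact ((PadicOrdGe.of_nat (p := p) _).pow 4 |>.mul (hb1.pow 4)).mono (by norm_num)
      have hs0 : PadicOrdGe p 0 (((n % p : ℕ) : ℚ) - 2 * ((k % p : ℕ) : ℚ)) := padicOrdGe_sub_two_mul _ _
      have hΦ := padicOrdGe_Phi hp2 hn hω (Nat.div_le_div_right hkn) (p := p)
      exact ((hs0.mul hB1).mul hΦ).mono (by norm_num)
    · exact PadicOrdGe.zero 1
  · -- a complete window: the block sum is exactly `0`
    set C₀ : ℚ := ((Nat.centralBinom q * Nat.centralBinom (n / p - q) : ℕ) : ℚ) ^ 4 * Phi p n ω q with hC₀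
    have hfib : ∑ k ∈ (Icc ℓ n).filter (fun k => k / p = q), termZ p n ω k =
        ∑ r ∈ range (n % p + 1), (((n % p : ℕ) : ℚ) - 2 * r) *
          ((((Nat.centralBinom r * Nat.centralBinom (n % p - r) : ℕ) : ℚ) ^ 4) * C₀) := by
      -- drop the terms with a borrow (they are `0`) and reindex by the units digit
      simp only [termZ]
      rw [← sum_filter]
      have hset : ((Icc ℓ n).filter (fun k => k / p = q)).filter (fun k => k % p ≤ n % p) =
          (range (n % p + 1)).image (fun r => q * p + r) := by
        ext k
        simp only [mem_filter, mem_Icc, mem_image, mem_range]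
        constructor
        · rintro ⟨⟨⟨hkl, hkn⟩, hkq⟩, hkr⟩
          refine ⟨k % p, by omega, ?_⟩
          have := Nat.div_add_mod k p
          rw [hkq, mul_comm] at this
          omega
        · rintro ⟨r, hr, rfl⟩
          have en := Nat.div_add_mod n p
          have hrp : r < p := by have := Nat.mod_lt n hp0; omega
          have hdiv : (q * p + r) / p = q := by
            rw [add_comm, Nat.add_mul_div_right _ _ hp0, Nat.div_eq_of_lt hrp, zero_add]
          have hmod : (q * p + r) % p = r := by
            rw [add_comm, Nat.add_mul_mod_self_right, Nat.mod_eq_of_lt hrp]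
          have hqp : (c₁ + 1) * p ≤ q * p := Nat.mul_le_mul_right p hgt
          have hqn' : q * p ≤ p * (n / p) := by rw [mul_comm]; exact Nat.mul_le_mul_left p hqn
          refine ⟨⟨⟨?_, ?_⟩, hdiv⟩, by rw [hmod]; omega⟩
          · have e1 : (c₁ + 1) * p = c₁ * p + p := by ring
            omega
          · omega
      rw [hset, sum_image]
      · refine sum_congr rfl fun r hr => ?_
        have hrp : r < p := by have := Nat.mod_lt n hp0; have := mem_range.1 hr; omega
        have hdiv : (q * p + r) / p = q := by
          rw [add_comm, Nat.add_mul_div_right _ _ hp0, Nat.div_eq_of_lt hrp, zero_add]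
        have hmod : (q * p + r) % p = r := by
          rw [add_comm, Nat.add_mul_mod_self_right, Nat.mod_eq_of_lt hrp]
        rw [hdiv, hmod, blockA, hC₀]
        ring
      · intro a _ b _ hab
        simpa using hab
    rw [hfib, window_antisymm]
    exact PadicOrdGe.zero 1

/-- **The window theorem.** For an odd prime `p`, `2n < p²`, a dangerous shift `ℓ = c'p + (p+1)/2 ≤ n`
(i.e. `p ∣ 2ℓ − 1`) and `p`-integral weights `ω_1, …, ω_4`:
`Σ_{k=ℓ}^{n} Σ_{i=1}^{4} ω_i · p^{4−i} r_{n,i,k} ≡ 0 (mod p)` — the tail sums over the poles gain one `p` over the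
termwise bound. [cite: LaiSprangZudilin2026, §5 (Lemma 5.3, proof)] -/
theorem window_sum (hp2 : p ≠ 2) {n c₁ : ℕ} (hn : 2 * n < p ^ 2) {ω : ℕ → ℚ}
    (hω : ∀ i ∈ Icc 1 4, PadicOrdGe p 0 (ω i)) :
    PadicOrdGe p 1 (∑ k ∈ Icc (c₁ * p + p / 2 + 1) n,
      ∑ i ∈ Icc 1 4, ω i * coeff (4 - i) (pTaylor p (Rreg n k) (-(k : ℚ)))) := by
  set ℓ := c₁ * p + p / 2 + 1 with hℓ
  have hXZ : ∀ k ∈ Icc ℓ n, PadicOrdGe p 1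
      (∑ i ∈ Icc 1 4, ω i * coeff (4 - i) (pTaylor p (Rreg n k) (-(k : ℚ))) - termZ p n ω k) := by
    intro k hk
    have hkn : k ≤ n := (mem_Icc.1 hk).2
    obtain ⟨_, hcong⟩ := pTaylor_Rreg_congr hp2 hkn hn (p := p)
    -- `X_k − Y_k`
    have h1 : PadicOrdGe p 1 (∑ i ∈ Icc 1 4, ω i * coeff (4 - i) (pTaylor p (Rreg n k) (-(k : ℚ))) -
        ((n : ℚ) - 2 * k) * Aval n k ^ 4 * Phi p n ω (k / p)) := by
      have := padicOrdGe_wsum hcong hω (fun i => 4 - i)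
      rw [Phi, mul_sum, ← sum_sub_distrib]
      convert this using 2 with i hi
      rw [map_sub, coeff_C_mul]; ring
    have h2 := Y_congr_Z hp2 hkn hn hω (p := p)
    have := h1.add h2
    convert this using 1; ring
  have hsplit : ∑ k ∈ Icc ℓ n, ∑ i ∈ Icc 1 4, ω i * coeff (4 - i) (pTaylor p (Rreg n k) (-(k : ℚ))) =
      ∑ k ∈ Icc ℓ n, (∑ i ∈ Icc 1 4, ω i * coeff (4 - i) (pTaylor p (Rreg n k) (-(k : ℚ))) - termZ p n ω k) +
        ∑ k ∈ Icc ℓ n, termZ p n ω k := by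
    rw [← sum_add_distrib]; exact sum_congr rfl fun k _ => by ring
  rw [hsplit]
  exact (PadicOrdGe.sum hXZ).add (sum_termZ hp2 hn hω)

end window

end Lemma53

/-! ## Lemma 5.3 -/

open Lemma53 in
/-- **`ord_p ρ_{n,0} ≥ −5` for every odd prime `p` with `2n < p²`** (as a `PadicOrdGe` statement about the
printed (def_rho_0) = `pfRho0`; the hypothesis `p > 3` of the printed lemma is not needed).  Proof: regroup
(def_rho_0) by the shift `ℓ`; for `p ∤ 2ℓ−1` every term has order `≥ −3`; for `p ∣ 2ℓ − 1 = pc` the inner sum is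
`p^{−6}·Σ_k Σ_i ω_i p^{4−i} r_{n,i,k}` with `ω_i = i(i+1)2^{i+2}c^{−i−2}`, and the window theorem gives one `p` back.
[cite: LaiSprangZudilin2026, §5 Lemma 5.3] -/
theorem padicOrdGe_pfRho0 {p : ℕ} [hp : Fact p.Prime] (hp2 : p ≠ 2) {n : ℕ} (hn : 2 * n < p ^ 2) :
    PadicOrdGe p (-5) (pfRho0 n) := by
  have hp0 : 0 < p := hp.out.pos
  have hp0' : (p : ℚ) ≠ 0 := by exact_mod_cast hp.out.ne_zero
  have hodd := two_mul_half_add_one hp2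
  -- regroup by `ℓ`
  have hre : pfRho0 n = -∑ ℓ ∈ Icc 1 n, ∑ k ∈ Icc ℓ n, ∑ i ∈ (Icc 1 4 : Finset ℕ),
      (i : ℚ) * ((i : ℚ) + 1) * coeffR n i k / (((ℓ : ℚ) - 1 / 2) ^ (i + 2)) := by
    rw [pfRho0, sum_comm]
    congr 1
    simp_rw [sum_comm (s := (Icc 1 4 : Finset ℕ))]
    exact sum_comm' fun k ℓ => by
      simp only [mem_range, mem_Icc]; omega
  rw [hre]
  refine padicOrdGe_neg (PadicOrdGe.sum fun ℓ hℓ => ?_)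
  have hℓ1 : 1 ≤ ℓ := (mem_Icc.1 hℓ).1
  have hℓn : ℓ ≤ n := (mem_Icc.1 hℓ).2
  -- the coefficients `r_{n,i,k} = p^{-(4-i)} · coeff_{4−i}(pTaylor)`
  have hcoeff : ∀ k i : ℕ, i ∈ (Icc 1 4 : Finset ℕ) →
      coeffR n i k = coeff (4 - i) (pTaylor p (Rreg n k) (-(k : ℚ))) / (p : ℚ) ^ (4 - i) := by
    intro k i hi
    have hi' := mem_Icc.1 hi
    rw [coeff_pTaylor_Rreg n k (by omega : 4 - i ≤ 3), show 4 - (4 - i) = i by omega,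
      mul_div_cancel_left₀ _ (pow_ne_zero _ hp0')]
  by_cases hdvd : p ∣ 2 * ℓ - 1
  · -- dangerous shift: `2ℓ − 1 = p c`, `ℓ = c' p + h + 1`
    obtain ⟨c, hc⟩ := hdvd
    have hcodd : Odd c := by
      have : Odd (p * c) := by rw [← hc, Nat.odd_iff]; omega
      exact (Nat.odd_mul.1 this).2
    obtain ⟨c₁, hc₁⟩ := hcodd
    have hℓeq : ℓ = c₁ * p + p / 2 + 1 := by
      have e1 : p * c = 2 * (c₁ * p) + p := by rw [hc₁]; ring
      omega
    have hcp : c < p := by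
      by_contra hcon
      have : p * p ≤ p * c := Nat.mul_le_mul_left p (not_lt.1 hcon)
      rw [sq] at hn; omega
    have hc0 : 0 < c := by omega
    have hcu : PadicOrdGe p 0 ((c : ℚ)⁻¹) := by
      have hnd : ¬ (p : ℤ) ∣ (c : ℤ) := fun h => Nat.not_dvd_of_pos_of_lt hc0 hcp (by exact_mod_cast h)
      have := PadicOrdGe.inv_of_int (p := p) (c := (c : ℤ)) (m := 0) (by rw [padicValInt.eq_zero_of_not_dvd hnd])
      simpa using this
    -- the weights
    set ω : ℕ → ℚ := fun i => (i : ℚ) * ((i : ℚ) + 1) * 2 ^ (i + 2) * ((c : ℚ)⁻¹) ^ (i + 2) with hω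
    have hωint : ∀ i ∈ (Icc 1 4 : Finset ℕ), PadicOrdGe p 0 (ω i) := by
      intro i _
      have h1 : PadicOrdGe p 0 ((i : ℚ) * ((i : ℚ) + 1) * 2 ^ (i + 2)) := by
        simpa using PadicOrdGe.of_nat (p := p) (i * (i + 1) * 2 ^ (i + 2))
      show PadicOrdGe p 0 ((i : ℚ) * ((i : ℚ) + 1) * 2 ^ (i + 2) * ((c : ℚ)⁻¹) ^ (i + 2))
      exact (h1.mul (hcu.pow (i + 2))).mono (by simp)
    have hW := window_sum hp2 hn hωint (p := p) (c₁ := c₁)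
    rw [← hℓeq] at hW
    -- identify the inner sum with `p^{-6} · (window sum)`
    have hℓhalf : ((ℓ : ℚ) - 1 / 2) = (p : ℚ) * c / 2 := by
      have : ((2 * ℓ - 1 : ℕ) : ℚ) = (p : ℚ) * c := by exact_mod_cast hc
      rw [Nat.cast_sub (by omega)] at this; push_cast at this
      linarith
    have hid : ∑ k ∈ Icc ℓ n, ∑ i ∈ (Icc 1 4 : Finset ℕ),
        (i : ℚ) * ((i : ℚ) + 1) * coeffR n i k / (((ℓ : ℚ) - 1 / 2) ^ (i + 2)) =
        (∑ k ∈ Icc ℓ n, ∑ i ∈ Icc 1 4, ω i * coeff (4 - i) (pTaylor p (Rreg n k) (-(k : ℚ)))) / (p : ℚ) ^ 6 := by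
      rw [sum_div]
      refine sum_congr rfl fun k _ => ?_
      rw [sum_div]
      refine sum_congr rfl fun i hi => ?_
      have hi' := mem_Icc.1 hi
      have hc0' : (c : ℚ) ≠ 0 := by exact_mod_cast hc0.ne'
      rw [hcoeff k i hi, hℓhalf, hω]
      simp only
      have e6 : (p : ℚ) ^ 6 = (p : ℚ) ^ (4 - i) * (p : ℚ) ^ (i + 2) := by
        rw [← pow_add]; congr 1; omega
      rw [e6, div_pow, mul_pow, inv_pow]
      have h2 : (2 : ℚ) ^ (i + 2) ≠ 0 := pow_ne_zero _ two_ne_zero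
      have hc2 : (c : ℚ) ^ (i + 2) ≠ 0 := pow_ne_zero _ hc0'
      have hp4 : (p : ℚ) ^ (4 - i) ≠ 0 := pow_ne_zero _ hp0'
      have hp5 : (p : ℚ) ^ (i + 2) ≠ 0 := pow_ne_zero _ hp0'
      field_simp
    rw [hid, div_eq_mul_inv]
    have hinv : PadicOrdGe p (-6) (((p : ℚ) ^ 6)⁻¹) := by
      refine PadicOrdGe.of_eq (le_of_eq ?_)
      rw [padicValRat.inv, padicValRat.pow, padicValRat.self hp.out.one_lt]; norm_num
    exact (hW.mul hinv).mono (by norm_num)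
  · -- harmless shift: every term has order `≥ −3`
    refine (PadicOrdGe.sum fun k hk => PadicOrdGe.sum fun i hi => ?_).mono (by norm_num : (-5 : ℤ) ≤ -3)
    have hkn : k ≤ n := (mem_Icc.1 hk).2
    have hi' := mem_Icc.1 hi
    obtain ⟨h0, -⟩ := Lemma53.pTaylor_Rreg_congr hp2 hkn hn (p := p)
    -- `ord_p r_{n,i,k} ≥ −(4 − i) ≥ −3`
    have hr : PadicOrdGe p (-3) (coeffR n i k) := by
      rw [hcoeff k i hi, div_eq_mul_inv]
      have h1 := h0 (4 - i)
      have h2 : PadicOrdGe p (-((4 - i : ℕ) : ℤ)) (((p : ℚ) ^ (4 - i))⁻¹) := by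
        refine PadicOrdGe.of_eq (le_of_eq ?_)
        rw [padicValRat.inv, padicValRat.pow, padicValRat.self hp.out.one_lt]; simp
      exact (h1.mul h2).mono (by omega)
    -- the half-integer power is a `p`-adic unit
    have hu : PadicOrdGe p 0 ((((ℓ : ℚ) - 1 / 2) ^ (i + 2))⁻¹) := by
      have e : ((ℓ : ℚ) - 1 / 2) = ((2 * ℓ - 1 : ℕ) : ℚ) * (2 : ℚ)⁻¹ := by
        rw [Nat.cast_sub (by omega)]; push_cast; ring
      rw [e, ← inv_pow, mul_inv, inv_inv]
      have hnd : ¬ (p : ℤ) ∣ ((2 * ℓ - 1 : ℕ) : ℤ) := fun h => hdvd (by exact_mod_cast h)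
      have h1 : PadicOrdGe p 0 (((2 * ℓ - 1 : ℕ) : ℚ))⁻¹ := by
        have := PadicOrdGe.inv_of_int (p := p) (c := ((2 * ℓ - 1 : ℕ) : ℤ)) (m := 0)
          (by rw [padicValInt.eq_zero_of_not_dvd hnd])
        simpa using this
      simpa using (h1.mul (PadicOrdGe.of_nat (p := p) 2)).pow (i + 2)
    have hii : PadicOrdGe p 0 ((i : ℚ) * ((i : ℚ) + 1)) := by
      simpa using PadicOrdGe.of_nat (p := p) (i * (i + 1))
    rw [div_eq_mul_inv]
    simpa using ((hii.mul hr).mul hu)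

/-- **Lemma 5.3** (DISCHARGED): for `n ≥ 1` and every prime `p > max{√(2n), 3}`, `v_p(ρ_{n,0}) ≥ −5`.
The proof here is elementary (`p`-scaled Taylor series of the brick form of `R_n(t)(t+k)^4`, Kummer–Lucas digits
and the reflection `k₀ ↦ m₀ − k₀` of the units digit inside each block), not the printed Andrews/₁₃V₁₂
transformation; it uses only `p` odd, so it also covers `p = 3`. [cite: LaiSprangZudilin2026, §5 Lemma 5.3] -/
theorem lemma53_holds : lemma53 := by
  intro n p hn hprime h3 hsq
  haveI : Fact p.Prime := ⟨hprime⟩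
  have hp2 : p ≠ 2 := by omega
  have h := padicOrdGe_pfRho0 hp2 hsq (p := p)
  rw [pfRho0_eq_rho0] at h
  rcases h with h | h
  · rw [h, padicValRat.zero]; norm_num
  · exact h

/-- **Lemma 5.4**, now unconditional: for `n ≥ 1`, `Π_n^{−1} d_n^6·ρ_{n,0} ∈ ℤ` with `Π_n = ∏_{max{√(2n),3} < p ≤ n} p`
(the tree's `lemma54_of` / `lemma54_of_lemma53` fed with `lemma51_holds` and `lemma53_holds`).
[cite: LaiSprangZudilin2026, §5 Lemma 5.4] -/
theorem lemma54 {n : ℕ} (hn : 1 ≤ n) :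
    ∃ z : ℤ, (Nat.lcmUpto n : ℚ) ^ 6 / (primeProd n : ℚ) * rho0 n = z :=
  lemma54_of_lemma53 lemma53_holds hn

end Literature.NumberTheory.Irrationality.LaiSprangZudilin2026
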